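import Summits.QuantumFields.YangMills.Theorems.BalabanUVNodesN15KingModelCombesThomasFormLipschitz
import HarnessLib

/-!
# BalabanUVNodes ∕ N15 — THE KING-MODEL RUNG (PART Ϧ-l): KING's EFFECTIVE LAPLACIAN `Δ_eff(U) = a − a²Q(U)G(U)Q(U)^*` IS `η`-UNIFORMLY LIPSCHITZ IN THE BACKGROUND — the covariant block mean is
# Lipschitz (`‖Q(U) − Q(V)‖·‖Q(W)^*‖ ≤ Dε` through `(Q(U)−Q(V))(Q(U)−Q(V))ᴴ = L^{−2(d+1)}·blockdiag Σ_j(U(Γ_j)−V(Γ_j))(U(Γ_j)−V(Γ_j))ᴴ`), the propagator is Lipschitz (PART Ϧ-h), hence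
# `‖Δ_eff(U) − Δ_eff(V)‖ ≤ a²·(2Dε∕κ + Lip_G)`; in King's scaling everything is a function of `Lε = ε∕η`: the block-field action depends on the background `η`-uniformly on the scale `ε₁η`
# (Track A, DAG node N15 = NE2; FAN-OUT v1.1 §N15 s3 «KING-MODEL RUNG … + what the curved case adds»; count-neutral)

HONEST FRAMING.  Count-neutral (cell `pub-ymgap`, seat `pub-ymgap-dag-n15-e` g50; `--supports stmt-QuantumFields-27247 --as helper` = K3ᴬ, KEY MAP v3).  King's one-level comparison model (PART Ϥ-k
`effLapU`, (2.14)), Bałaban's one-level covariant block mean, unitary link fields, any fibre; operator norms.  NOT the background at two scales (the two-spacing `η`-rate of `(Δ_eff(U))⁻¹`, g49's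
located caveat (t5⁵⁵)); NOT Bałaban's multi-level objects; NOT a node discharge (N15 of record untouched); nothing continuum ∕ ℝ⁴ ∕ OS ∕ Clay.

THE RESULTS (`T` a tree contour system of depth `≤ D`; unitary `U, V` with `‖U_b − V_b‖ ≤ ε` on every bond):
* §1 `norm_one_le_one'`, `blk_covQ_sub_mul_conjTranspose` (`blk ((Q(U)−Q(V))(Q(U)−Q(V))ᴴ) y y′ = [y = y′]·L^{−2(d+1)}Σ_j (U(Γ_j)−V(Γ_j))(U(Γ_j)−V(Γ_j))ᴴ`), ★ `l2_opNorm_covQ_sub_sq_le`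
  (`‖Q(U) − Q(V)‖² ≤ L^{−(d+1)}(Dε)²`), `l2_opNorm_covQ_sq_le` (`‖Q(U)‖² ≤ L^{−(d+1)}`), `l2_opNorm_kingQadjU_sq_le` (`‖Q(U)^*‖² ≤ L^{d+1}`), ★ `l2_opNorm_covQ_mul_kingQadjU_le` (`‖Q(V)‖·‖Q(U)^*‖ ≤ 1`),
  ★ `l2_opNorm_covQ_sub_mul_kingQadjU_le` (`‖Q(U) − Q(V)‖·‖Q(W)^*‖ ≤ Dε`).
* §2 `effLapU_sub_effLapU` (the three-term split), ★★★ **`l2_opNorm_effLapU_sub_le_of_lip`** (`‖Δ_eff(U) − Δ_eff(V)‖ ≤ a²(2Dε·γ + Λ)` given `‖G(U)‖,‖G(V)‖ ≤ γ` and `‖G(U) − G(V)‖ ≤ Λ`),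
  ★★★★ **`l2_opNorm_effLapU_sub_le`** (both `A₀` `κ`-coercive, `a, c, m² ≥ 0`, `s = √c·ε`: `‖Δ_eff(U) − Δ_eff(V)‖ ≤ a²·(2Dε∕κ + 2√(d+1)s∕(κ√κ) + (2(d+1)s² + 2aDε)∕κ²)`),
  ★★★★ **`l2_opNorm_effLapU_sub_le_king`** (King's scaling, comb, every `L ≥ 1`: `≤ a²·(2(d+1)(Lε)∕κ + 2√(d+1)(Lε)∕(κ√κ) + 2(d+1)((Lε)² + a(Lε))∕κ²)` — a function of `Lε = ε∕η` ONLY).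
PRIOR TREE ART (by name): Ϧ-h (`l2_opNorm_fullOpU_inv_sub_le`), Ϧ-a (`l2_opNorm_inv_le_of_reCoercive`), Ϛ-l (`l2_opNorm_le_of_blk_symm`), Ϥ-c∕Ϥ-d∕Ϥ-k (`covQ`, `covQ_apply_site`, `covQ_mul_conjTranspose`,
`kingQadjU`, `fullOpU`, `effLapU`), Ϥ-h (`norm_treeHol_sub_le`), `King1986.Torus` (`site`, `blockEquiv`), Mathlib (`Matrix.l2_opNorm_conjTranspose_mul_self`, `Matrix.l2_opNorm_mul`, `Matrix.l2_opNorm_conjTranspose`).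
Dedup (rg at filing): basename 0 files; needles `blk_covQ_sub_mul_conjTranspose|l2_opNorm_covQ_sub_sq_le|l2_opNorm_effLapU_sub_le` 0 tree files.  Locators: [King1986] (2.14) p.653, (4.34) p.674, (4.44)–(4.45)
p.675; [Balaban1985BackgroundPropagators] (3.19) p.393, (3.25) p.394, (3.48)–(3.50) pp.398–400 (shape); [Dimock2013] App. D (coin).  0 `sorry`, 0 `def`.
-/

noncomputable section
open scoped BigOperators ComplexConjugate ComplexOrder InnerProductSpace Matrix.Norms.L2Operator
open Finset Matrix WithLp

namespace Summit.QuantumFields.YangMills.BalabanUVNodes.N15KingModelRung.CombesThomas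

open Literature.MathematicalPhysics.QuantumFieldTheory.LatticeDiamagneticInequality (blk)
open Literature.MathematicalPhysics.QuantumFieldTheory.Balaban1983to89.B5Prop11Plancherel (Tor fine unitVec)
open Literature.MathematicalPhysics.QuantumFieldTheory.King1986.Torus (site blockOf blockOf_site blockEquiv blockEquiv_apply)
open Summit.QuantumFields.YangMills.BalabanUVNodes.N15KingModelRung.Covariant (fib l2_opNorm_le_of_blk_symm l2_opNorm_of_mem_unitaryGroup_le)
open Summit.QuantumFields.YangMills.BalabanUVNodes.N15KingModelRung.CovariantBlock
  (BlockTree kingComb kingComb_depth_le covQ covQ_apply_site covQ_mul_conjTranspose kingQadjU fullOpU effLapU treeHol norm_treeHol_sub_le)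

variable {d : ℕ} {L : ℕ} [NeZero L] (T : BlockTree d L) (M : Fin (d + 1) → ℕ) [hM : ∀ μ, NeZero (M μ)]
variable {𝕜 : Type*} [RCLike 𝕜] {n : Type*} [Fintype n] [DecidableEq n]

/-! ## §1 The covariant block mean is Lipschitz in the field -/

section BlockMean

omit [NeZero L] hM in
/-- `‖1‖ ≤ 1` for the `ℓ²` operator norm (any finite index type). [folklore] -/
theorem norm_one_le_one' {ι : Type*} [Fintype ι] [DecidableEq ι] : ‖(1 : Matrix ι ι 𝕜)‖ ≤ 1 := by
  rw [Matrix.cstar_norm_def, map_one]; exact ContinuousLinearMap.norm_id_le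

/-- THE GRAM BLOCKS OF `Q(U) − Q(V)`: `blk ((Q(U)−Q(V))(Q(U)−Q(V))ᴴ) y y′ = [y = y′]·L^{−2(d+1)}·Σ_j (U(Γ_j)−V(Γ_j))(U(Γ_j)−V(Γ_j))ᴴ`. [cite: Balaban1985BackgroundPropagators, (3.19) p.393] -/
theorem blk_covQ_sub_mul_conjTranspose (U V : Tor (fine L M) × Fin (d + 1) → Matrix n n 𝕜) (y y' : Tor M) :
    blk ((covQ T M U - covQ T M V) * (covQ T M U - covQ T M V)ᴴ) y y'
      = if y = y' then ((((L : ℝ) ^ (d + 1))⁻¹ ^ 2 : ℝ) : 𝕜) • ∑ j : Fin (d + 1) → Fin L, (treeHol M T U y j - treeHol M T V y j) * (treeHol M T U y j - treeHol M T V y j)ᴴ else 0 := by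
  have hc : ((L : 𝕜) ^ (d + 1))⁻¹ = (((((L : ℝ) ^ (d + 1))⁻¹ : ℝ)) : 𝕜) := by push_cast; ring
  have hQ : ∀ (W : Tor (fine L M) × Fin (d + 1) → Matrix n n 𝕜) (b b' : Tor M) (i k : n) (j : Fin (d + 1) → Fin L),
      (covQ T M U - covQ T M W) (b, i) (site L M b' j, k) = if b = b' then (((((L : ℝ) ^ (d + 1))⁻¹ : ℝ)) : 𝕜) * (treeHol M T U b j - treeHol M T W b j) i k else 0 := by
    intro W b b' i k j
    rw [Matrix.sub_apply, covQ_apply_site, covQ_apply_site, hc]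
    by_cases h : b = b'
    · rw [if_pos h, if_pos h, if_pos h, Matrix.sub_apply, mul_sub]
    · rw [if_neg h, if_neg h, if_neg h, sub_zero]
  ext i i'
  simp only [blk, Matrix.of_apply, Matrix.mul_apply, Matrix.conjTranspose_apply]
  rw [Fintype.sum_prod_type, ← (blockEquiv L M).sum_comp, Fintype.sum_prod_type]
  simp only [blockEquiv_apply, hQ V]
  by_cases h : y = y'
  · subst h
    rw [if_pos rfl, Finset.sum_eq_single y]
    · simp only [if_true, Matrix.smul_apply, Matrix.sum_apply, Matrix.mul_apply, Matrix.conjTranspose_apply, smul_eq_mul, Finset.mul_sum, star_mul', RCLike.star_def, RCLike.conj_ofReal]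
      refine Finset.sum_congr rfl fun j _ => Finset.sum_congr rfl fun k _ => ?_
      push_cast; ring
    · intro b _ hb; exact Finset.sum_eq_zero fun j _ => Finset.sum_eq_zero fun k _ => by rw [if_neg (Ne.symm hb), zero_mul]
    · intro hy; exact absurd (Finset.mem_univ y) hy
  · rw [if_neg h]
    refine Finset.sum_eq_zero fun b _ => Finset.sum_eq_zero fun j _ => Finset.sum_eq_zero fun k _ => ?_
    by_cases hb : y = b
    · have hb' : ¬ y' = b := fun h' => h (hb.trans h'.symm)
      rw [if_neg hb', star_zero, mul_zero]
    · rw [if_neg hb, zero_mul]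

/-- ★ **THE COVARIANT BLOCK MEAN IS LIPSCHITZ**: `‖Q(U) − Q(V)‖² ≤ L^{−(d+1)}·(Dε)²` for unitary `U, V` with `‖U_b − V_b‖ ≤ ε` and contours of depth `≤ D` (`‖U(Γ) − V(Γ)‖ ≤ Dε`, PART Ϥ-h).
[cite: Balaban1985BackgroundPropagators, (3.19) p.393, (3.48) p.398 (shape)] -/
theorem l2_opNorm_covQ_sub_sq_le {D : ℕ} (hD : ∀ j, T.depth j ≤ D) {U V : Tor (fine L M) × Fin (d + 1) → Matrix n n 𝕜} (hU : ∀ bd, U bd ∈ Matrix.unitaryGroup n 𝕜)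
    (hV : ∀ bd, V bd ∈ Matrix.unitaryGroup n 𝕜) {ε : ℝ} (hε0 : 0 ≤ ε) (hε : ∀ bd, ‖U bd - V bd‖ ≤ ε) :
    ‖covQ T M U - covQ T M V‖ ^ 2 ≤ ((L : ℝ) ^ (d + 1))⁻¹ * ((D : ℝ) * ε) ^ 2 := by
  have hL0 : (0 : ℝ) < (L : ℝ) ^ (d + 1) := by have : (0 : ℝ) < L := (by exact_mod_cast Nat.pos_of_ne_zero (NeZero.ne L)); positivity
  have hcard : (Fintype.card (Fin (d + 1) → Fin L) : ℝ) = (L : ℝ) ^ (d + 1) := by rw [Fintype.card_fun, Fintype.card_fin, Fintype.card_fin]; push_cast; ring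
  -- `‖X‖² = ‖X Xᴴ‖`
  have hsq : ‖covQ T M U - covQ T M V‖ ^ 2 = ‖(covQ T M U - covQ T M V) * (covQ T M U - covQ T M V)ᴴ‖ := by
    have h := Matrix.l2_opNorm_conjTranspose_mul_self (covQ T M U - covQ T M V)ᴴ
    rw [conjTranspose_conjTranspose, Matrix.l2_opNorm_conjTranspose] at h
    rw [h, sq]
  rw [hsq]
  -- block-diagonal Schur bound
  have hblk : ∀ y y', ‖blk ((covQ T M U - covQ T M V) * (covQ T M U - covQ T M V)ᴴ) y y'‖ ≤ if y = y' then ((L : ℝ) ^ (d + 1))⁻¹ * ((D : ℝ) * ε) ^ 2 else 0 := by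
    intro y y'
    rw [blk_covQ_sub_mul_conjTranspose]
    by_cases h : y = y'
    · subst h
      rw [if_pos rfl, if_pos rfl, norm_smul, RCLike.norm_ofReal, abs_of_nonneg (by positivity)]
      have hterm : ∀ j : Fin (d + 1) → Fin L, ‖(treeHol M T U y j - treeHol M T V y j) * (treeHol M T U y j - treeHol M T V y j)ᴴ‖ ≤ ((D : ℝ) * ε) ^ 2 := fun j => by
        have h1 := norm_treeHol_sub_le T M hU hV hε y j
        have h2 : (T.depth j : ℝ) * ε ≤ (D : ℝ) * ε := mul_le_mul_of_nonneg_right (by exact_mod_cast hD j) hε0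
        calc ‖(treeHol M T U y j - treeHol M T V y j) * (treeHol M T U y j - treeHol M T V y j)ᴴ‖
            ≤ ‖treeHol M T U y j - treeHol M T V y j‖ * ‖(treeHol M T U y j - treeHol M T V y j)ᴴ‖ := Matrix.l2_opNorm_mul _ _
          _ ≤ ((D : ℝ) * ε) * ((D : ℝ) * ε) := by
              rw [Matrix.l2_opNorm_conjTranspose]; exact mul_le_mul (h1.trans h2) (h1.trans h2) (norm_nonneg _) (by positivity)
          _ = ((D : ℝ) * ε) ^ 2 := by ring
      calc ((L : ℝ) ^ (d + 1))⁻¹ ^ 2 * ‖∑ j : Fin (d + 1) → Fin L, (treeHol M T U y j - treeHol M T V y j) * (treeHol M T U y j - treeHol M T V y j)ᴴ‖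
          ≤ ((L : ℝ) ^ (d + 1))⁻¹ ^ 2 * ∑ j : Fin (d + 1) → Fin L, ((D : ℝ) * ε) ^ 2 :=
            mul_le_mul_of_nonneg_left ((norm_sum_le _ _).trans (Finset.sum_le_sum fun j _ => hterm j)) (by positivity)
        _ = ((L : ℝ) ^ (d + 1))⁻¹ * ((D : ℝ) * ε) ^ 2 := by
            rw [Finset.sum_const, Finset.card_univ, nsmul_eq_mul, hcard]; field_simp
    · rw [if_neg h, if_neg h, norm_zero]
  refine l2_opNorm_le_of_blk_symm M hblk (R := ((L : ℝ) ^ (d + 1))⁻¹ * ((D : ℝ) * ε) ^ 2) (fun y => ?_) (fun y' => ?_)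
  · rw [Finset.sum_ite_eq Finset.univ y, if_pos (Finset.mem_univ _)]
  · rw [Finset.sum_ite_eq' Finset.univ y', if_pos (Finset.mem_univ _)]

/-- `‖Q(U)‖² ≤ L^{−(d+1)}` (`Q(U)Q(U)ᴴ = L^{−(d+1)}·1`, PART Ϥ-c). [cite: Balaban1985BackgroundPropagators, (3.19) p.393] -/
theorem l2_opNorm_covQ_sq_le {U : Tor (fine L M) × Fin (d + 1) → Matrix n n 𝕜} (hU : ∀ bd, U bd ∈ Matrix.unitaryGroup n 𝕜) : ‖covQ T M U‖ ^ 2 ≤ ((L : ℝ) ^ (d + 1))⁻¹ := by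
  have hL0 : (0 : ℝ) < (L : ℝ) ^ (d + 1) := by have : (0 : ℝ) < L := (by exact_mod_cast Nat.pos_of_ne_zero (NeZero.ne L)); positivity
  have h := Matrix.l2_opNorm_conjTranspose_mul_self (covQ T M U)ᴴ
  rw [conjTranspose_conjTranspose, Matrix.l2_opNorm_conjTranspose, covQ_mul_conjTranspose T M hU] at h
  rw [sq, ← h, show ((L : 𝕜) ^ (d + 1))⁻¹ = (((((L : ℝ) ^ (d + 1))⁻¹ : ℝ)) : 𝕜) by push_cast; ring, norm_smul, RCLike.norm_ofReal, abs_of_nonneg (by positivity)]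
  exact (mul_le_mul_of_nonneg_left norm_one_le_one' (by positivity)).trans (le_of_eq (mul_one _))

/-- `‖Q(U)^*‖² ≤ L^{d+1}` (King's `η`-adjoint `Q(U)^* = L^{d+1}Q(U)ᴴ`). [cite: King1986, (2.13) p.653] -/
theorem l2_opNorm_kingQadjU_sq_le {U : Tor (fine L M) × Fin (d + 1) → Matrix n n 𝕜} (hU : ∀ bd, U bd ∈ Matrix.unitaryGroup n 𝕜) : ‖kingQadjU T M U‖ ^ 2 ≤ (L : ℝ) ^ (d + 1) := by
  have hL0 : (0 : ℝ) < (L : ℝ) ^ (d + 1) := by have : (0 : ℝ) < L := (by exact_mod_cast Nat.pos_of_ne_zero (NeZero.ne L)); positivity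
  rw [kingQadjU, show ((L : 𝕜) ^ (d + 1)) = ((((L : ℝ) ^ (d + 1) : ℝ)) : 𝕜) by push_cast; ring, norm_smul, RCLike.norm_ofReal, abs_of_nonneg hL0.le, Matrix.l2_opNorm_conjTranspose, mul_pow]
  calc ((L : ℝ) ^ (d + 1)) ^ 2 * ‖covQ T M U‖ ^ 2 ≤ ((L : ℝ) ^ (d + 1)) ^ 2 * ((L : ℝ) ^ (d + 1))⁻¹ := mul_le_mul_of_nonneg_left (l2_opNorm_covQ_sq_le T M hU) (by positivity)
    _ = (L : ℝ) ^ (d + 1) := by field_simp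

/-- ★ `‖Q(V)‖·‖Q(U)^*‖ ≤ 1` for unitary `U, V`. [cite: King1986, (2.13) p.653] -/
theorem l2_opNorm_covQ_mul_kingQadjU_le {U V : Tor (fine L M) × Fin (d + 1) → Matrix n n 𝕜} (hU : ∀ bd, U bd ∈ Matrix.unitaryGroup n 𝕜) (hV : ∀ bd, V bd ∈ Matrix.unitaryGroup n 𝕜) :
    ‖covQ T M V‖ * ‖kingQadjU T M U‖ ≤ 1 := by
  have h1 := l2_opNorm_covQ_sq_le T M hV
  have h2 := l2_opNorm_kingQadjU_sq_le T M hU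
  have hL0 : (0 : ℝ) < (L : ℝ) ^ (d + 1) := by have : (0 : ℝ) < L := (by exact_mod_cast Nat.pos_of_ne_zero (NeZero.ne L)); positivity
  have hsq : (‖covQ T M V‖ * ‖kingQadjU T M U‖) ^ 2 ≤ 1 := by
    rw [mul_pow]
    calc ‖covQ T M V‖ ^ 2 * ‖kingQadjU T M U‖ ^ 2 ≤ ((L : ℝ) ^ (d + 1))⁻¹ * (L : ℝ) ^ (d + 1) := mul_le_mul h1 h2 (sq_nonneg _) (by positivity)
      _ = 1 := inv_mul_cancel₀ hL0.ne'
  nlinarith [mul_nonneg (norm_nonneg (covQ T M V)) (norm_nonneg (kingQadjU T M U))]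

/-- ★ `‖Q(U) − Q(V)‖·‖Q(W)^*‖ ≤ Dε` — the covariant block mean is Lipschitz in King's `η`-normalised pairing. [cite: Balaban1985BackgroundPropagators, (3.19) p.393, (3.48) p.398 (shape)] -/
theorem l2_opNorm_covQ_sub_mul_kingQadjU_le {D : ℕ} (hD : ∀ j, T.depth j ≤ D) {U V W : Tor (fine L M) × Fin (d + 1) → Matrix n n 𝕜} (hU : ∀ bd, U bd ∈ Matrix.unitaryGroup n 𝕜)
    (hV : ∀ bd, V bd ∈ Matrix.unitaryGroup n 𝕜) (hW : ∀ bd, W bd ∈ Matrix.unitaryGroup n 𝕜) {ε : ℝ} (hε0 : 0 ≤ ε) (hε : ∀ bd, ‖U bd - V bd‖ ≤ ε) :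
    ‖covQ T M U - covQ T M V‖ * ‖kingQadjU T M W‖ ≤ (D : ℝ) * ε := by
  have h1 := l2_opNorm_covQ_sub_sq_le T M hD hU hV hε0 hε
  have h2 := l2_opNorm_kingQadjU_sq_le T M hW
  have hL0 : (0 : ℝ) < (L : ℝ) ^ (d + 1) := by have : (0 : ℝ) < L := (by exact_mod_cast Nat.pos_of_ne_zero (NeZero.ne L)); positivity
  have hsq : (‖covQ T M U - covQ T M V‖ * ‖kingQadjU T M W‖) ^ 2 ≤ ((D : ℝ) * ε) ^ 2 := by
    rw [mul_pow]
    calc ‖covQ T M U - covQ T M V‖ ^ 2 * ‖kingQadjU T M W‖ ^ 2 ≤ (((L : ℝ) ^ (d + 1))⁻¹ * ((D : ℝ) * ε) ^ 2) * (L : ℝ) ^ (d + 1) := mul_le_mul h1 h2 (sq_nonneg _) (by positivity)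
      _ = ((D : ℝ) * ε) ^ 2 := by field_simp
  exact abs_le_of_sq_le_sq' hsq (by positivity) |>.2.trans (le_of_eq rfl) |> fun h => (le_abs_self _).trans ((abs_of_nonneg (by positivity)).le.trans h)

end BlockMean

/-! ## §2 The effective Laplacian is Lipschitz in the background -/

section EffLap

/-- The three-term split: `Δ_eff(U) − Δ_eff(V) = −a²·[(Q(U)−Q(V))G(U)Q(U)^* + Q(V)(G(U)−G(V))Q(U)^* + Q(V)G(V)(Q(U)^*−Q(V)^*)]`. [cite: King1986, (2.14) p.653] -/
theorem effLapU_sub_effLapU (a c m2 : ℝ) (U V : Tor (fine L M) × Fin (d + 1) → Matrix n n 𝕜) :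
    effLapU T M a c m2 U - effLapU T M a c m2 V
      = -(((a ^ 2 : ℝ) : 𝕜) • ((covQ T M U - covQ T M V) * (fullOpU T M a c m2 U)⁻¹ * kingQadjU T M U
          + covQ T M V * ((fullOpU T M a c m2 U)⁻¹ - (fullOpU T M a c m2 V)⁻¹) * kingQadjU T M U
          + covQ T M V * (fullOpU T M a c m2 V)⁻¹ * (kingQadjU T M U - kingQadjU T M V))) := by
  rw [effLapU, effLapU]
  simp only [Matrix.sub_mul, Matrix.mul_sub, smul_add, smul_sub]
  abel

/-- ★★★ **`Δ_eff` IS LIPSCHITZ GIVEN THE PROPAGATOR BOUNDS**: with `‖G(U)‖, ‖G(V)‖ ≤ γ` and `‖G(U) − G(V)‖ ≤ Λ` (unitary `U, V` with `‖U_b − V_b‖ ≤ ε`, depth `≤ D`):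
`‖Δ_eff(U) − Δ_eff(V)‖ ≤ a²·(2Dε·γ + Λ)`. [cite: King1986, (2.14) p.653, (4.34) p.674] -/
theorem l2_opNorm_effLapU_sub_le_of_lip {D : ℕ} (hD : ∀ j, T.depth j ≤ D) (a c m2 : ℝ) {U V : Tor (fine L M) × Fin (d + 1) → Matrix n n 𝕜} (hU : ∀ bd, U bd ∈ Matrix.unitaryGroup n 𝕜)
    (hV : ∀ bd, V bd ∈ Matrix.unitaryGroup n 𝕜) {ε : ℝ} (hε0 : 0 ≤ ε) (hε : ∀ bd, ‖U bd - V bd‖ ≤ ε) {γ Λ : ℝ}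
    (hGU : ‖(fullOpU T M a c m2 U)⁻¹‖ ≤ γ) (hGV : ‖(fullOpU T M a c m2 V)⁻¹‖ ≤ γ) (hΛ : ‖(fullOpU T M a c m2 U)⁻¹ - (fullOpU T M a c m2 V)⁻¹‖ ≤ Λ) :
    ‖effLapU T M a c m2 U - effLapU T M a c m2 V‖ ≤ a ^ 2 * (2 * ((D : ℝ) * ε) * γ + Λ) := by
  set GU := (fullOpU T M a c m2 U)⁻¹
  set GV := (fullOpU T M a c m2 V)⁻¹
  have hq1 := l2_opNorm_covQ_sub_mul_kingQadjU_le T M hD hU hV hU hε0 hε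
  have hq2 := l2_opNorm_covQ_mul_kingQadjU_le T M hU hV
  have hq3 : ‖covQ T M V‖ * ‖kingQadjU T M U - kingQadjU T M V‖ ≤ (D : ℝ) * ε := by
    have h : kingQadjU T M U - kingQadjU T M V = ((L : 𝕜) ^ (d + 1)) • (covQ T M U - covQ T M V)ᴴ := by rw [kingQadjU, kingQadjU, conjTranspose_sub, smul_sub]
    have hV' : ‖covQ T M V‖ = ‖(covQ T M V)ᴴ‖ := (Matrix.l2_opNorm_conjTranspose _).symm
    have e : ‖covQ T M V‖ * ‖kingQadjU T M U - kingQadjU T M V‖ = ‖covQ T M U - covQ T M V‖ * ‖kingQadjU T M V‖ := by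
      rw [h, kingQadjU, norm_smul, norm_smul, Matrix.l2_opNorm_conjTranspose, Matrix.l2_opNorm_conjTranspose]; ring
    rw [e]; exact l2_opNorm_covQ_sub_mul_kingQadjU_le T M hD hU hV hV hε0 hε
  -- the three terms
  have t1 : ‖(covQ T M U - covQ T M V) * GU * kingQadjU T M U‖ ≤ (D : ℝ) * ε * γ := by
    calc ‖(covQ T M U - covQ T M V) * GU * kingQadjU T M U‖ ≤ ‖covQ T M U - covQ T M V‖ * ‖GU‖ * ‖kingQadjU T M U‖ :=
          (Matrix.l2_opNorm_mul _ _).trans (mul_le_mul_of_nonneg_right (Matrix.l2_opNorm_mul _ _) (norm_nonneg _))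
      _ = (‖covQ T M U - covQ T M V‖ * ‖kingQadjU T M U‖) * ‖GU‖ := by ring
      _ ≤ (D : ℝ) * ε * γ := mul_le_mul hq1 hGU (norm_nonneg _) (by positivity)
  have t2 : ‖covQ T M V * (GU - GV) * kingQadjU T M U‖ ≤ Λ := by
    calc ‖covQ T M V * (GU - GV) * kingQadjU T M U‖ ≤ ‖covQ T M V‖ * ‖GU - GV‖ * ‖kingQadjU T M U‖ :=
          (Matrix.l2_opNorm_mul _ _).trans (mul_le_mul_of_nonneg_right (Matrix.l2_opNorm_mul _ _) (norm_nonneg _))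
      _ = (‖covQ T M V‖ * ‖kingQadjU T M U‖) * ‖GU - GV‖ := by ring
      _ ≤ 1 * Λ := mul_le_mul hq2 hΛ (norm_nonneg _) zero_le_one
      _ = Λ := one_mul Λ
  have t3 : ‖covQ T M V * GV * (kingQadjU T M U - kingQadjU T M V)‖ ≤ (D : ℝ) * ε * γ := by
    calc ‖covQ T M V * GV * (kingQadjU T M U - kingQadjU T M V)‖ ≤ ‖covQ T M V‖ * ‖GV‖ * ‖kingQadjU T M U - kingQadjU T M V‖ :=
          (Matrix.l2_opNorm_mul _ _).trans (mul_le_mul_of_nonneg_right (Matrix.l2_opNorm_mul _ _) (norm_nonneg _))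
      _ = (‖covQ T M V‖ * ‖kingQadjU T M U - kingQadjU T M V‖) * ‖GV‖ := by ring
      _ ≤ (D : ℝ) * ε * γ := mul_le_mul hq3 hGV (norm_nonneg _) (by positivity)
  rw [effLapU_sub_effLapU, norm_neg, norm_smul, RCLike.norm_ofReal, abs_of_nonneg (sq_nonneg a)]
  refine mul_le_mul_of_nonneg_left ?_ (sq_nonneg a)
  calc ‖(covQ T M U - covQ T M V) * GU * kingQadjU T M U + covQ T M V * (GU - GV) * kingQadjU T M U + covQ T M V * GV * (kingQadjU T M U - kingQadjU T M V)‖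
      ≤ ‖(covQ T M U - covQ T M V) * GU * kingQadjU T M U‖ + ‖covQ T M V * (GU - GV) * kingQadjU T M U‖ + ‖covQ T M V * GV * (kingQadjU T M U - kingQadjU T M V)‖ :=
        (norm_add_le _ _).trans (add_le_add (norm_add_le _ _) le_rfl)
    _ ≤ (D : ℝ) * ε * γ + Λ + (D : ℝ) * ε * γ := add_le_add (add_le_add t1 t2) t3
    _ = 2 * ((D : ℝ) * ε) * γ + Λ := by ring

/-- ★★★★ **KING's EFFECTIVE LAPLACIAN IS LIPSCHITZ IN THE BACKGROUND** (H¹ currency): unitary `U, V` with `‖U_b − V_b‖ ≤ ε` bondwise, both `A₀` `κ`-coercive, `a, c, m² ≥ 0`, contours of depth `≤ D`,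
`s = √c·ε`:  `‖Δ_eff(U) − Δ_eff(V)‖ ≤ a²·(2Dε∕κ + 2√(d+1)s∕(κ√κ) + (2(d+1)s² + 2aDε)∕κ²)`. [cite: King1986, (2.14) p.653, (4.34) p.674; Balaban1985BackgroundPropagators, (3.48)–(3.50) pp.398–400 (shape)] -/
theorem l2_opNorm_effLapU_sub_le {D : ℕ} (hD : ∀ j, T.depth j ≤ D) {a c m2 : ℝ} (ha : 0 ≤ a) (hc : 0 ≤ c) (hm : 0 ≤ m2) {U V : Tor (fine L M) × Fin (d + 1) → Matrix n n 𝕜}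
    (hU : ∀ bd, U bd ∈ Matrix.unitaryGroup n 𝕜) (hV : ∀ bd, V bd ∈ Matrix.unitaryGroup n 𝕜) {ε : ℝ} (hε0 : 0 ≤ ε) (hε : ∀ bd, ‖U bd - V bd‖ ≤ ε) {κ : ℝ} (hκ : 0 < κ)
    (hcoU : ∀ v : Tor (fine L M) × n → 𝕜, κ * ∑ x, ‖fib (fine L M) v x‖ ^ 2 ≤ RCLike.re (star v ⬝ᵥ (fullOpU T M a c m2 U *ᵥ v)))
    (hcoV : ∀ v : Tor (fine L M) × n → 𝕜, κ * ∑ x, ‖fib (fine L M) v x‖ ^ 2 ≤ RCLike.re (star v ⬝ᵥ (fullOpU T M a c m2 V *ᵥ v))) :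
    ‖effLapU T M a c m2 U - effLapU T M a c m2 V‖
      ≤ a ^ 2 * (2 * ((D : ℝ) * ε) * κ⁻¹ + (2 * Real.sqrt ((d : ℝ) + 1) * (Real.sqrt c * ε) / (κ * Real.sqrt κ) + (2 * ((d : ℝ) + 1) * (Real.sqrt c * ε) ^ 2 + 2 * (a * D * ε)) / κ ^ 2)) :=
  l2_opNorm_effLapU_sub_le_of_lip T M hD a c m2 hU hV hε0 hε (l2_opNorm_inv_le_of_reCoercive (fine L M) hκ hcoU) (l2_opNorm_inv_le_of_reCoercive (fine L M) hκ hcoV)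
    (l2_opNorm_fullOpU_inv_sub_le T M ha hc hm hD hU hV hε0 hε hκ hcoU hcoV)

/-- ★★★★ **KING's SCALING: THE BLOCK-FIELD ACTION DEPENDS ON THE BACKGROUND `η`-UNIFORMLY ON BAŁABAN's SCALE** — `c = L²`, comb contours, `a, m² ≥ 0`, every `L`; unitary `U, V` with
`‖U_b − V_b‖ ≤ ε` bondwise, both `A₀` `κ`-coercive:  `‖Δ_eff(U) − Δ_eff(V)‖ ≤ a²·(2(d+1)(Lε)∕κ + 2√(d+1)(Lε)∕(κ√κ) + 2(d+1)((Lε)² + a(Lε))∕κ²)` — a function of `Lε = ε∕η` only.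
[cite: King1986, (2.14) p.653, (4.34) p.674; Balaban1985BackgroundPropagators, (3.37) p.396, (3.48)–(3.50) pp.398–400 (shape)] -/
theorem l2_opNorm_effLapU_sub_le_king {a m2 : ℝ} (ha : 0 ≤ a) (hm : 0 ≤ m2) {U V : Tor (fine L M) × Fin (d + 1) → Matrix n n 𝕜}
    (hU : ∀ bd, U bd ∈ Matrix.unitaryGroup n 𝕜) (hV : ∀ bd, V bd ∈ Matrix.unitaryGroup n 𝕜) {ε : ℝ} (hε0 : 0 ≤ ε) (hε : ∀ bd, ‖U bd - V bd‖ ≤ ε) {κ : ℝ} (hκ : 0 < κ)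
    (hcoU : ∀ v : Tor (fine L M) × n → 𝕜, κ * ∑ x, ‖fib (fine L M) v x‖ ^ 2 ≤ RCLike.re (star v ⬝ᵥ (fullOpU (kingComb d L) M a ((L : ℝ) ^ 2) m2 U *ᵥ v)))
    (hcoV : ∀ v : Tor (fine L M) × n → 𝕜, κ * ∑ x, ‖fib (fine L M) v x‖ ^ 2 ≤ RCLike.re (star v ⬝ᵥ (fullOpU (kingComb d L) M a ((L : ℝ) ^ 2) m2 V *ᵥ v))) :
    ‖effLapU (kingComb d L) M a ((L : ℝ) ^ 2) m2 U - effLapU (kingComb d L) M a ((L : ℝ) ^ 2) m2 V‖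
      ≤ a ^ 2 * (2 * ((d : ℝ) + 1) * ((L : ℝ) * ε) * κ⁻¹ + (2 * Real.sqrt ((d : ℝ) + 1) * ((L : ℝ) * ε) / (κ * Real.sqrt κ) + 2 * ((d : ℝ) + 1) * (((L : ℝ) * ε) ^ 2 + a * ((L : ℝ) * ε)) / κ ^ 2)) := by
  have hL0 : (0 : ℝ) ≤ L := Nat.cast_nonneg L
  have hD : ((((d + 1) * (L - 1) : ℕ)) : ℝ) ≤ ((d : ℝ) + 1) * L := by
    have : (((L - 1 : ℕ)) : ℝ) ≤ L := by exact_mod_cast Nat.sub_le L 1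
    push_cast; nlinarith
  have hΛ := l2_opNorm_fullOpU_inv_sub_le_king (kingComb d L) M ha hm hU hV hε0 hε hκ hcoU hcoV rfl rfl
  have h := l2_opNorm_effLapU_sub_le_of_lip (kingComb d L) M kingComb_depth_le a ((L : ℝ) ^ 2) m2 hU hV hε0 hε
    (l2_opNorm_inv_le_of_reCoercive (fine L M) hκ hcoU) (l2_opNorm_inv_le_of_reCoercive (fine L M) hκ hcoV) hΛ
  refine h.trans (mul_le_mul_of_nonneg_left (add_le_add ?_ le_rfl) (sq_nonneg a))
  have hk : 0 ≤ κ⁻¹ := inv_nonneg.mpr hκ.le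
  calc 2 * ((((d + 1) * (L - 1) : ℕ) : ℝ) * ε) * κ⁻¹ ≤ 2 * ((((d : ℝ) + 1) * L) * ε) * κ⁻¹ := by
        refine mul_le_mul_of_nonneg_right (mul_le_mul_of_nonneg_left (mul_le_mul_of_nonneg_right hD hε0) (by norm_num)) hk
    _ = 2 * ((d : ℝ) + 1) * ((L : ℝ) * ε) * κ⁻¹ := by ring

end EffLap

end Summit.QuantumFields.YangMills.BalabanUVNodes.N15KingModelRung.CombesThomas

end
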